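import Summits.NavierStokesRegularity.FunctionalMining.BiaxialAxisCalculus
import HarnessLib

/-!
# FunctionalMining — THEOREM R of `SIEVELD.md` §3.4b (4e), steps (i)–(ii), in the kernel: the axis of an
# exact periodic biaxial strain is TWIST-FREE with `σ₂(∇n) = 0` (every dimension; `d = 3`: `n·curl n = 0`)

Search for candidate a priori estimates; no regularity claim. Cell `pub-nsfunc`, prove seat (gen 20).
Static calculus of smooth fields on the flat torus; nothing about Navier–Stokes dynamics.

SETTING. `v, n : T^d → ℝ^d` smooth, `∑ᵢ nᵢ² ≡ 1`, `m ≠ 0`, and `S(v)(x) = m(1 − 3 n(x)⊗n(x))` for every `x`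
(an exact periodic biaxial strain with a globally oriented smooth axis; the fully three-dimensional case
left open by `BiaxialEikonalObstruction` / `BiaxialXRay`). Notation `b_{lk} = ∂ₖn_l`, `a = (n·∇)n`,
`θ = div n`, as in `BiaxialAxisCalculus`.

* `svForm_axis_eq_zero`: `J(n⊗n; w) ≡ 0` (`J(S(v); w) = 0` by Saint-Venant, `BiaxialSaintVenant`, and
  `J` is affine-equivariant, `S(v) = m·1 − 3m·n⊗n`).
* `inc_identity`: hence, by the geometric identity `svForm_axis`, POINTWISE
  `2(|∇n|² − |a|²) = tr((∇n)²) + θ²` (SIEVELD (4e)(i): `σ₂(∇n) = (n·curl n)²`).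
* `integral_div_sq_eq_integral_trace_sq` (NULL LAGRANGIAN, every smooth `n`, no constraint):
  `∫ θ² = ∫ tr((∇n)²)`, because `θ² − tr((∇n)²) = div(θ n − a)` (`div_sq_sub_trace_sq_eq_sum_partialDeriv`).
* `twist_sq_algebra` (algebra under `|n| = 1`): `|∇n|² − |a|² − tr((∇n)²) = ½∑ₗₖ(c_{lk} − c_{kl})²`,
  `c = ∇n − a⊗n`.
* **`twistFree`**: `∇n − a⊗n` is SYMMETRIC at every point (`b_{lk} − a_l n_k = b_{kl} − a_k n_l`), and
  **`div_sq_eq_trace_sq`**: `θ² = tr((∇n)²)` at every point — SIEVELD (4e)(ii) "`n·curl n ≡ 0` and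
  `σ₂(∇n) ≡ 0`"; `twist_eq_zero_fin3`: at `d = Fin 3`, `n·curl n = 0` literally.
What this is NOT: steps (iii)–(v) of THEOREM R (Frobenius foliation, flat complete leaves,
Hartman–Nirenberg rulings, unbounded growth) are not formalised; no existence or non-existence statement
about the fully 3-D biaxial problem is made here beyond these necessary conditions; no verdict change.
[ours = assembly; SIEVELD (4e)(i)–(ii) two-party at paper level (census-2 INC-IDENTITY-B), here
kernel-checked]
-/

noncomputable section

open MeasureTheory Set Filter Topology

namespace Summit.NavierStokesRegularity.FunctionalMining
open Literature.Analysis Literature.Analysis.FunctionSpaces Literature.Analysis.FunctionSpaces.Torus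
  Literature.Analysis.FluidPDE

namespace BiaxialEikonal

variable {d : Type*} [Fintype d] [DecidableEq d]

/-! ## 1. The null Lagrangian `θ² − tr((∇n)²) = div(θ n − (n·∇)n)` (every smooth `n`) -/

section NullLagrangian

variable {n : UnitAddTorus d → EuclideanSpace ℝ d} (hn : Torus.IsSmooth n)
include hn

/-- The divergence as a sum of diagonal partials, at function level. [folklore] -/
theorem divergence_fun : Torus.divergence n = fun y => ∑ j, Torus.partialDeriv j n y j :=
  funext fun y => divergence_eq_sum_partialDeriv_apply (hn.isContDiff (by simp)) y

/-- The self-convection `(n·∇)n` componentwise: `((n·∇)n)_k = ∑ⱼ nⱼ ∂ⱼn_k`. [folklore] -/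
theorem convect_self_apply (y : UnitAddTorus d) (k : d) :
    Torus.convect n n y k = ∑ j, n y j * Torus.partialDeriv j n y k := by
  rw [convect_eq_sum_smul_partialDeriv (hn.isContDiff (by simp))]
  simp [Finset.sum_apply]

/-- `∂ₖ θ = ∑ⱼ (∂ₖ∂ⱼ n)ⱼ`. [folklore] -/
theorem partialDeriv_divergence (k : d) (x : UnitAddTorus d) :
    Torus.partialDeriv k (Torus.divergence n) x = ∑ j, Torus.partialDeriv k (Torus.partialDeriv j n) x j := by
  rw [divergence_fun hn, partialDeriv_finset_sum _ (fun j _ => c1_dcomp hn j j)]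
  exact Finset.sum_congr rfl fun j _ => partialDeriv_apply_coord ((hn.partialDeriv j).isContDiff (by simp)) k x j

/-- `∂ₖ ((n·∇)n)_k = ∑ⱼ (∂ₖnⱼ ∂ⱼn_k + nⱼ (∂ₖ∂ⱼn)_k)`. [folklore] -/
theorem partialDeriv_convect_self (k : d) (x : UnitAddTorus d) :
    Torus.partialDeriv k (fun y => Torus.convect n n y k) x =
      ∑ j, (Torus.partialDeriv k n x j * Torus.partialDeriv j n x k
        + n x j * Torus.partialDeriv k (Torus.partialDeriv j n) x k) := by
  have hfun : (fun y => Torus.convect n n y k) = fun y => ∑ j, n y j * Torus.partialDeriv j n y k :=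
    funext fun y => convect_self_apply hn y k
  have hs : ∀ j, Torus.IsContDiff 1 (fun y => n y j * Torus.partialDeriv j n y k) :=
    fun j => ContDiff.mul (c1_comp hn j) (c1_dcomp hn j k)
  rw [hfun, partialDeriv_finset_sum _ (fun j _ => hs j)]
  refine Finset.sum_congr rfl fun j _ => ?_
  rw [partialDeriv_mul (c1_comp hn j) (c1_dcomp hn j k), partialDeriv_apply_coord (hn.isContDiff (by simp)),
    partialDeriv_apply_coord ((hn.partialDeriv j).isContDiff (by simp))]
  ring

/-- The flux `G_k := θ n_k − ((n·∇)n)_k` is smooth. [folklore] -/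
theorem isSmooth_flux (k : d) :
    Torus.IsSmooth (fun y => Torus.divergence n y * n y k - Torus.convect n n y k) := by
  have h1 : Torus.IsSmooth (fun y => Torus.divergence n y * n y k) := ContDiff.mul hn.divergence (hn.apply k)
  exact h1.sub ((hn.convect hn).apply k)

/-- **`θ² − tr((∇n)²) = ∑ₖ ∂ₖ(θ n_k − ((n·∇)n)_k)`** pointwise, for every smooth `n`. [folklore: `σ₂(∇n)`
is a null Lagrangian, `σ₂ = ½ div((div n) n − (n·∇)n)`] -/
theorem div_sq_sub_trace_sq_eq_sum_partialDeriv (x : UnitAddTorus d) :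
    (∑ k, Torus.partialDeriv k n x k) ^ 2 - ∑ l, ∑ k, Torus.partialDeriv k n x l * Torus.partialDeriv l n x k =
      ∑ k, Torus.partialDeriv k (fun y => Torus.divergence n y * n y k - Torus.convect n n y k) x := by
  have hterm : ∀ k, Torus.partialDeriv k (fun y => Torus.divergence n y * n y k - Torus.convect n n y k) x =
      (Torus.divergence n x * Torus.partialDeriv k n x k
        + (∑ j, Torus.partialDeriv k (Torus.partialDeriv j n) x j) * n x k)
      - ∑ j, (Torus.partialDeriv k n x j * Torus.partialDeriv j n x k
        + n x j * Torus.partialDeriv k (Torus.partialDeriv j n) x k) := by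
    intro k
    have hA : Torus.IsContDiff 1 (fun y => Torus.divergence n y * n y k) :=
      ContDiff.mul (hn.divergence.isContDiff (by simp)) (c1_comp hn k)
    have hB : Torus.IsContDiff 1 (fun y => Torus.convect n n y k) :=
      ((hn.convect hn).apply k).isContDiff (by simp)
    rw [show (fun y => Torus.divergence n y * n y k - Torus.convect n n y k) =
        (fun y => Torus.divergence n y * n y k) - fun y => Torus.convect n n y k from rfl,
      partialDeriv_sub hA hB, Pi.sub_apply,
      partialDeriv_mul (hn.divergence.isContDiff (by simp)) (c1_comp hn k),
      partialDeriv_apply_coord (hn.isContDiff (by simp)), partialDeriv_divergence hn,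
      partialDeriv_convect_self hn]
  simp only [hterm, Finset.sum_sub_distrib, Finset.sum_add_distrib]
  have hθ : Torus.divergence n x = ∑ k, Torus.partialDeriv k n x k :=
    divergence_eq_sum_partialDeriv_apply (hn.isContDiff (by simp)) x
  -- the two second-derivative sums coincide
  have hZ : ∑ k, (∑ j, Torus.partialDeriv k (Torus.partialDeriv j n) x j) * n x k =
      ∑ k, ∑ j, n x j * Torus.partialDeriv k (Torus.partialDeriv j n) x k := by
    rw [Finset.sum_comm]
    simp only [Finset.sum_mul]
    exact Finset.sum_congr rfl fun j _ => Finset.sum_congr rfl fun k _ => by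
      rw [axis_hess_symm hn k j k x]; ring
  have hsq : (∑ k, Torus.partialDeriv k n x k) ^ 2 = ∑ k, Torus.divergence n x * Torus.partialDeriv k n x k := by
    rw [hθ, sq, Finset.mul_sum]
  have htr : ∑ l, ∑ k, Torus.partialDeriv k n x l * Torus.partialDeriv l n x k =
      ∑ k, ∑ j, Torus.partialDeriv k n x j * Torus.partialDeriv j n x k :=
    Finset.sum_congr rfl fun l _ => Finset.sum_congr rfl fun k _ => by ring
  rw [hZ, hsq, htr]
  ring

/-- **NULL LAGRANGIAN: `∫ (div n)² = ∫ tr((∇n)²)`** for every smooth field `n` on the torus. [folklore] -/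
theorem integral_div_sq_eq_integral_trace_sq :
    ∫ x, (∑ k, Torus.partialDeriv k n x k) ^ 2 =
      ∫ x, ∑ l, ∑ k, Torus.partialDeriv k n x l * Torus.partialDeriv l n x k := by
  have hdiff : ∫ x, ((∑ k, Torus.partialDeriv k n x k) ^ 2 -
      ∑ l, ∑ k, Torus.partialDeriv k n x l * Torus.partialDeriv l n x k) = 0 := by
    simp_rw [div_sq_sub_trace_sq_eq_sum_partialDeriv hn]
    rw [integral_finsetSum _ fun k _ => ((isSmooth_flux hn k).partialDeriv k).integrable]
    exact Finset.sum_eq_zero fun k _ => integral_partialDeriv_eq_zero_holds (isSmooth_flux hn k) k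
  have hi1 : Integrable (fun x => (∑ k, Torus.partialDeriv k n x k) ^ 2) volume := by
    have : Torus.IsSmooth (fun x => (∑ k, Torus.partialDeriv k n x k) ^ 2) := by
      have h := hn.divergence
      rw [divergence_fun hn] at h
      exact ContDiff.pow h 2
    exact this.integrable
  have hi2 : Integrable (fun x => ∑ l, ∑ k, Torus.partialDeriv k n x l * Torus.partialDeriv l n x k) volume := by
    refine integrable_finsetSum _ fun l _ => integrable_finsetSum _ fun k _ => ?_
    have : Torus.IsSmooth (fun x => Torus.partialDeriv k n x l * Torus.partialDeriv l n x k) :=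
      ContDiff.mul ((hn.partialDeriv k).apply l) ((hn.partialDeriv l).apply k)
    exact this.integrable
  rw [integral_sub hi1 hi2] at hdiff
  linarith

end NullLagrangian

/-! ## 2. Pointwise algebra under `|n| = 1` -/

omit [DecidableEq d] in
/-- **`|∇n|² − |a|² − tr((∇n)²) = ½ ∑ₗₖ (c_{lk} − c_{kl})²`** with `c_{lk} = b_{lk} − a_l n_k`,
`a_l = ∑ₖ b_{lk} n_k`, whenever `∑ⱼ nⱼ b_{jk} = 0` for all `k` and `∑ nᵢ² = 1` (pure algebra on a real
matrix `b` and vector `n`). [folklore] -/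
theorem twist_sq_algebra (b : d → d → ℝ) (n : d → ℝ) (hn1 : ∑ i, n i ^ 2 = 1)
    (hnb : ∀ k, ∑ j, n j * b j k = 0) :
    (∑ l, ∑ k, b l k ^ 2) - (∑ l, (∑ k, b l k * n k) ^ 2) - ∑ l, ∑ k, b l k * b k l =
      (1 / 2) * ∑ l, ∑ k, ((b l k - (∑ j, b l j * n j) * n k) - (b k l - (∑ j, b k j * n j) * n l)) ^ 2 := by
  set a : d → ℝ := fun l => ∑ j, b l j * n j with ha
  have hna : ∑ l, n l * a l = 0 := by
    simp only [ha, Finset.mul_sum]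
    rw [Finset.sum_comm]
    have : ∀ j, ∑ l, n l * (b l j * n j) = (∑ l, n l * b l j) * n j := fun j => by
      rw [Finset.sum_mul]; exact Finset.sum_congr rfl fun l _ => by ring
    simp only [this, hnb, zero_mul, Finset.sum_const_zero]
  -- expand the square: ½∑(c_lk − c_kl)² = ∑ c_lk² − ∑ c_lk c_kl
  have hexp : (1 / 2 : ℝ) * ∑ l, ∑ k, ((b l k - a l * n k) - (b k l - a k * n l)) ^ 2 =
      (∑ l, ∑ k, (b l k - a l * n k) ^ 2) - ∑ l, ∑ k, (b l k - a l * n k) * (b k l - a k * n l) := by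
    have hsymm : ∑ l, ∑ k, (b k l - a k * n l) ^ 2 = ∑ l, ∑ k, (b l k - a l * n k) ^ 2 := Finset.sum_comm
    have : ∑ l, ∑ k, ((b l k - a l * n k) - (b k l - a k * n l)) ^ 2 =
        (∑ l, ∑ k, (b l k - a l * n k) ^ 2) + (∑ l, ∑ k, (b k l - a k * n l) ^ 2)
          - 2 * ∑ l, ∑ k, (b l k - a l * n k) * (b k l - a k * n l) := by
      rw [Finset.mul_sum, ← Finset.sum_add_distrib, ← Finset.sum_sub_distrib]
      refine Finset.sum_congr rfl fun l _ => ?_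
      rw [Finset.mul_sum, ← Finset.sum_add_distrib, ← Finset.sum_sub_distrib]
      exact Finset.sum_congr rfl fun k _ => by ring
    rw [this, hsymm]; ring
  -- ∑ c_lk² = |b|² − 2|a|² + |a|²|n|²
  have hc2 : ∑ l, ∑ k, (b l k - a l * n k) ^ 2 =
      (∑ l, ∑ k, b l k ^ 2) - 2 * (∑ l, a l * ∑ k, b l k * n k) + (∑ l, a l ^ 2) * ∑ k, n k ^ 2 := by
    rw [Finset.sum_mul, Finset.mul_sum, ← Finset.sum_sub_distrib, ← Finset.sum_add_distrib]
    refine Finset.sum_congr rfl fun l _ => ?_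
    rw [Finset.mul_sum, Finset.mul_sum, Finset.mul_sum, ← Finset.sum_sub_distrib, ← Finset.sum_add_distrib]
    exact Finset.sum_congr rfl fun k _ => by ring
  -- ∑ c_lk c_kl = tr b² − 2 ∑ₖ a_k (∑_l n_l b_lk) + (n·a)²
  have hcc : ∑ l, ∑ k, (b l k - a l * n k) * (b k l - a k * n l) =
      (∑ l, ∑ k, b l k * b k l) - 2 * (∑ k, a k * ∑ l, n l * b l k) + (∑ l, n l * a l) * ∑ k, n k * a k := by
    have e : ∀ l k, (b l k - a l * n k) * (b k l - a k * n l) =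
        b l k * b k l - a k * (n l * b l k) - a l * (n k * b k l) + (n l * a l) * (n k * a k) := fun l k => by ring
    simp only [e, Finset.sum_add_distrib, Finset.sum_sub_distrib]
    have t1 : ∑ l, ∑ k, a k * (n l * b l k) = ∑ k, a k * ∑ l, n l * b l k := by
      rw [Finset.sum_comm]; exact Finset.sum_congr rfl fun k _ => by rw [Finset.mul_sum]
    have t2 : ∑ l, ∑ k, a l * (n k * b k l) = ∑ k, a k * ∑ l, n l * b l k :=
      Finset.sum_congr rfl fun l _ => by rw [Finset.mul_sum]
    have t3 : ∑ l, ∑ k, (n l * a l) * (n k * a k) = (∑ l, n l * a l) * ∑ k, n k * a k := by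
      rw [Finset.sum_mul_sum]
    rw [t1, t2, t3]; ring
  rw [hexp, hc2, hcc]
  simp only [hnb, mul_zero, Finset.sum_const_zero, hn1, hna]
  have : ∑ l, a l * ∑ k, b l k * n k = ∑ l, a l ^ 2 := Finset.sum_congr rfl fun l _ => by rw [ha, sq]
  rw [this]
  have : ∑ l, (∑ k, b l k * n k) ^ 2 = ∑ l, a l ^ 2 := Finset.sum_congr rfl fun l _ => by rw [ha]
  rw [this]
  ring

/-! ## 3. THEOREM R (i)–(ii): twist-freeness and `σ₂ = 0` of the axis of an exact biaxial strain -/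

section Biaxial

variable {v n : UnitAddTorus d → EuclideanSpace ℝ d} (hv : Torus.IsSmooth v) (hn : Torus.IsSmooth n)
  (hn1 : ∀ x, ∑ i, n x i ^ 2 = 1) {m : ℝ} (hm : m ≠ 0)
  (hS : ∀ x, torusStrainMatrix v x = m • (1 - (3 : ℝ) • Matrix.vecMulVec (n x) (n x)))
include hv hn hm hS

/-- **`J(n⊗n; w) ≡ 0`** for the axis of an exact biaxial strain: `0 = J(S(v); w) = −3m·J(n⊗n; w)`. [ours] -/
theorem svForm_axis_eq_zero (w : d → ℝ) (x : UnitAddTorus d) :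
    svForm (fun y => Matrix.vecMulVec (n y) (n y)) w x = 0 := by
  have hP : ∀ i j, Torus.IsSmooth (entryFun (fun y => Matrix.vecMulVec (n y) (n y)) i j) := fun i j => by
    rw [entryFun_axis]
    exact ContDiff.mul (hn.apply i) (hn.apply j)
  have hQP : ∀ y i j, torusStrainMatrix v y i j =
      (m • (1 : Matrix d d ℝ)) i j + (-3 * m) * (fun y => Matrix.vecMulVec (n y) (n y)) y i j := by
    intro y i j
    rw [hS y]
    simp only [Matrix.smul_apply, Matrix.sub_apply, Matrix.one_apply, Matrix.vecMulVec_apply, smul_eq_mul]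
    ring
  have h := svForm_affine hP (m • (1 : Matrix d d ℝ)) (-3 * m) hQP w x
  rw [svForm_torusStrainMatrix_eq_zero hv] at h
  have h3 : (-3 * m) ≠ 0 := mul_ne_zero (by norm_num) hm
  exact (mul_eq_zero.mp h.symm).resolve_left h3

include hn1

/-- **THE POINTWISE INC IDENTITY (SIEVELD §3.4b (4e)(i))**: for the axis of an exact biaxial strain,
`2(|∇n|² − |(n·∇)n|²) = tr((∇n)²) + (div n)²` at every point (`σ₂(∇n) = τ²` in `d = 3`). [ours] -/
theorem inc_identity (x : UnitAddTorus d) :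
    2 * (∑ l, ∑ k, Torus.partialDeriv k n x l ^ 2 - ∑ l, (∑ k, Torus.partialDeriv k n x l * n x k) ^ 2) =
      (∑ l, ∑ k, Torus.partialDeriv k n x l * Torus.partialDeriv l n x k)
        + (∑ k, Torus.partialDeriv k n x k) ^ 2 := by
  have h := svForm_axis hn hn1 x
  rw [svForm_axis_eq_zero hv hn hm hS] at h
  linarith

/-- **TWIST-FREENESS (SIEVELD §3.4b (4e)(ii), first half): `∇n − a⊗n` is symmetric at every point**,
`∂ₖn_l − a_l n_k = ∂ₗn_k − a_k n_l` (`a = (n·∇)n`); in `d = 3` this is `n·curl n = 0`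
(`twist_eq_zero_fin3`), i.e. the plane field `n^⊥` is integrable. Proof: integrate the inc identity,
use the null Lagrangian `∫θ² = ∫tr((∇n)²)` to get `∫(|∇n|² − |a|² − tr((∇n)²)) = 0`, whose integrand is the
non-negative `½∑(c_{lk} − c_{kl})²` (`twist_sq_algebra`) and continuous, hence `≡ 0`. [ours] -/
theorem twistFree (x : UnitAddTorus d) (l k : d) :
    Torus.partialDeriv k n x l - (∑ j, Torus.partialDeriv j n x l * n x j) * n x k =
      Torus.partialDeriv l n x k - (∑ j, Torus.partialDeriv j n x k * n x j) * n x l := by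
  -- the non-negative integrand
  set F : UnitAddTorus d → ℝ := fun y => ∑ l, ∑ k,
    ((Torus.partialDeriv k n y l - (∑ j, Torus.partialDeriv j n y l * n y j) * n y k)
      - (Torus.partialDeriv l n y k - (∑ j, Torus.partialDeriv j n y k * n y j) * n y l)) ^ 2 with hF
  have hFid : ∀ y, (∑ l, ∑ k, Torus.partialDeriv k n y l ^ 2) - (∑ l, (∑ k, Torus.partialDeriv k n y l * n y k) ^ 2)
      - ∑ l, ∑ k, Torus.partialDeriv k n y l * Torus.partialDeriv l n y k = (1 / 2) * F y := fun y =>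
    twist_sq_algebra (fun l k => Torus.partialDeriv k n y l) (fun i => n y i) (hn1 y)
      (fun k => unit_first hn hn1 k y)
  -- its integral vanishes
  have hi_tr : Integrable (fun y => ∑ l, ∑ k, Torus.partialDeriv k n y l * Torus.partialDeriv l n y k) volume := by
    refine integrable_finsetSum _ fun l _ => integrable_finsetSum _ fun k _ => ?_
    have : Torus.IsSmooth (fun y => Torus.partialDeriv k n y l * Torus.partialDeriv l n y k) :=
      ContDiff.mul ((hn.partialDeriv k).apply l) ((hn.partialDeriv l).apply k)
    exact this.integrable
  have hi_θ : Integrable (fun y => (∑ k, Torus.partialDeriv k n y k) ^ 2) volume := by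
    have : Torus.IsSmooth (fun y => (∑ k, Torus.partialDeriv k n y k) ^ 2) :=
      ContDiff.pow (ContDiff.sum fun k _ => (hn.partialDeriv k).apply k) 2
    exact this.integrable
  have hint0 : ∫ y, (1 / 2) * F y = 0 := by
    have hpt : ∀ y, (1 / 2) * F y =
        (∑ k, Torus.partialDeriv k n y k) ^ 2 / 2
          - (∑ l, ∑ k, Torus.partialDeriv k n y l * Torus.partialDeriv l n y k) / 2 := by
      intro y
      rw [← hFid y]
      have := inc_identity hv hn hn1 hm hS y
      linarith
    simp_rw [hpt]
    rw [integral_sub (hi_θ.div_const 2) (hi_tr.div_const 2), integral_div, integral_div,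
      integral_div_sq_eq_integral_trace_sq hn]
    ring
  -- `F` is continuous, non-negative with zero integral, hence zero
  have hFcont : Continuous F := by
    have hb : ∀ k l, Continuous fun y => Torus.partialDeriv k n y l := fun k l => ((hn.partialDeriv k).apply l).continuous
    have hc : ∀ l, Continuous fun y => n y l := fun l => (hn.apply l).continuous
    refine continuous_finsetSum _ fun l _ => continuous_finsetSum _ fun k _ => Continuous.pow ?_ 2
    refine ((hb k l).sub ((continuous_finsetSum _ fun j _ => (hb j l).mul (hc j)).mul (hc k))).sub
      ((hb l k).sub ((continuous_finsetSum _ fun j _ => (hb j k).mul (hc j)).mul (hc l)))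
  have hFnn : ∀ y, 0 ≤ F y := fun y =>
    Finset.sum_nonneg fun l _ => Finset.sum_nonneg fun k _ => sq_nonneg _
  have hFint : Integrable F volume := hFcont.integrable_unitAddTorus
  have hF0 : ∫ y, F y = 0 := by
    have := hint0; rw [integral_const_mul] at this; linarith
  have hae : F =ᵐ[volume] 0 := (integral_eq_zero_iff_of_nonneg hFnn hFint).1 hF0
  have hzero : F = 0 := (Continuous.ae_eq_iff_eq volume hFcont continuous_const).1 hae
  have hFx : F x = 0 := congrFun hzero x
  -- a sum of squares vanishes termwise
  have hterm := (Finset.sum_eq_zero_iff_of_nonneg fun l _ =>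
    Finset.sum_nonneg fun k _ => sq_nonneg _).1 hFx l (Finset.mem_univ l)
  have hterm2 := (Finset.sum_eq_zero_iff_of_nonneg fun k _ => sq_nonneg _).1 hterm k (Finset.mem_univ k)
  exact sub_eq_zero.1 (pow_eq_zero_iff two_ne_zero |>.1 hterm2)

/-- **`σ₂(∇n) = 0` (SIEVELD §3.4b (4e)(ii), second half): `(div n)² = tr((∇n)²)` at every point** for the
axis of an exact biaxial strain (from the inc identity and twist-freeness: `|∇n|² − |a|² = tr((∇n)²)`).
In `d = 3`: the second fundamental form of the (integrable) plane field `n^⊥` has zero determinant —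
every leaf is a flat surface. [ours] -/
theorem div_sq_eq_trace_sq (x : UnitAddTorus d) :
    (∑ k, Torus.partialDeriv k n x k) ^ 2 = ∑ l, ∑ k, Torus.partialDeriv k n x l * Torus.partialDeriv l n x k := by
  have hF0 : ∑ l, ∑ k, ((Torus.partialDeriv k n x l - (∑ j, Torus.partialDeriv j n x l * n x j) * n x k)
      - (Torus.partialDeriv l n x k - (∑ j, Torus.partialDeriv j n x k * n x j) * n x l)) ^ 2 = 0 :=
    Finset.sum_eq_zero fun l _ => Finset.sum_eq_zero fun k _ => by
      rw [twistFree hv hn hn1 hm hS x l k, sub_self, zero_pow two_ne_zero]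
  have halg := twist_sq_algebra (fun l k => Torus.partialDeriv k n x l) (fun i => n x i) (hn1 x)
    (fun k => unit_first hn hn1 k x)
  rw [hF0, mul_zero] at halg
  have hinc := inc_identity hv hn hn1 hm hS x
  linarith

end Biaxial

/-- **`d = 3`: THE AXIS IS TWIST-FREE, `n·curl n = 0`** (SIEVELD §3.4b (4e)(ii) verbatim): for smooth
`v, n : T³ → ℝ³` with `|n| = 1` and `S(v) = m(1 − 3n⊗n)`, `m ≠ 0`,
`n₀(∂₁n₂ − ∂₂n₁) + n₁(∂₂n₀ − ∂₀n₂) + n₂(∂₀n₁ − ∂₁n₀) = 0` at every point. [ours] -/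
theorem twist_eq_zero_fin3 {v n : UnitAddTorus (Fin 3) → EuclideanSpace ℝ (Fin 3)} (hv : Torus.IsSmooth v)
    (hn : Torus.IsSmooth n) (hn1 : ∀ x, ∑ i, n x i ^ 2 = 1) {m : ℝ} (hm : m ≠ 0)
    (hS : ∀ x, torusStrainMatrix v x = m • (1 - (3 : ℝ) • Matrix.vecMulVec (n x) (n x)))
    (x : UnitAddTorus (Fin 3)) :
    n x 0 * (Torus.partialDeriv 1 n x 2 - Torus.partialDeriv 2 n x 1)
      + n x 1 * (Torus.partialDeriv 2 n x 0 - Torus.partialDeriv 0 n x 2)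
      + n x 2 * (Torus.partialDeriv 0 n x 1 - Torus.partialDeriv 1 n x 0) = 0 := by
  have t21 := twistFree hv hn hn1 hm hS x 2 1
  have t02 := twistFree hv hn hn1 hm hS x 0 2
  have t10 := twistFree hv hn hn1 hm hS x 1 0
  linear_combination (n x 0) * t21 + (n x 1) * t02 + (n x 2) * t10

end BiaxialEikonal

end Summit.NavierStokesRegularity.FunctionalMining

end
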